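import Summits.ValiantsHypothesis.ValiantsHypothesis.Theses.BinomialElusive

/-!
# `stub_integralDeep` (crux `BinomialCandidate`, stmt-ValiantsHypothesis-7392) fails at level `7`

Negative-lane certificate (refuter crux-attack (a), 2026-08-17) for the deciding crux's open stub
DEEP-INTEGRAL of `Cruxes/BinomialCandidate/Lines/registered.lean` (v6, `Stmt.stub_integralDeep`), whose data are
GENERAL exponents `a b : Fin m → ℕ` and whose conclusion is a nonzero relation of `ℓ¹`-length `≤ ⌊log₂ m⌋²`.

THE SWALLOWER (a "piece design", found by the seat's exhaustive enumeration of graded two-term designs, Exp. E):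
with `u₁ = t¹⁷ + t²¹`, `u₂ = t²² + t⁵⁴`, `u₃ = t⁷² + t⁸⁰`, `m = t⁷⁶` (i.e. `x^{n}+x^{w-n}` pieces of weights
`1, 2, 4` and the monomial `x²`, `x = t³⁸`, at the generic point `r = 11/19`, `s = 36/19`, `n₁ = (s-1)/2`),
the quadratic map `Γ = (y₀, y₁² - 2y₃, y₀y₂ - y₃y₀, y₃y₁, y₂² - 2y₃², y₄, y₅) : ℂ⁶ → ℂ⁷` sends
`p = (u₁, u₂, u₃, m, t⁵⁵¹ + t⁷⁰⁶, t⁷³⁷ + t¹⁰⁹⁶)` to SEVEN unit binomials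
`tᵃⁱ + tᵇⁱ`, `a = (17, 44, 89, 98, 144, 551, 737)`, `b = (21, 108, 101, 130, 160, 706, 1096)`
(Chebyshev `u₂² - 2m`, `u₃² - 2m²`, the shift `m u₂`, and the cyclotomic coupling
`u₁ (u₃ - m) = t⁸⁹ + t¹⁰¹`, `(1+y)(1-y+y²) = 1+y³`), and these fourteen exponents admit NO nonzero integer
relation of `ℓ¹`-length `≤ 4 = ⌊log₂ 7⌋²` (kernel-checked exhaustive certificate `noRel`, 29 961 lattice points);
the shortest relation has length `5` (`2·17 + 21 + 89 = 144`).  The solution is INTEGRAL (`p(0) = 0`), the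
Jacobian at the base point has corank exactly `2` (kernel `⟨e₁, e₂⟩`), the corank-two configuration is DEGENERATE
(the left kernel `⟨e₂, e₃, e₄⟩` sees only the form `y₂²` on the kernel plane, common zero `e₁`), and the structure
at infinity holds with `z = e₀` (`B_i(e₀) = 0` for all `i`; `dΓ(0)·e₀` vanishes off `i = 0`).  Hence every
hypothesis of the level-`7` body of `Stmt.stub_integralDeep` holds and its conclusion fails:

* `integralDeep_level_seven_false` — the level-`7` body is false;
* `eight_le_of_integralDeep_witness` — every witness `m₀` of `Stmt.stub_integralDeep` has `8 ≤ m₀`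
  (the body at level `m` is quoted verbatim; compare `four_le_of_binomialCandidate_witness`).

The same core works at levels `5` (no padding) and `6`; it says nothing about `m ≥ 8` (threshold `9 > 5`).
What it shows: with GENERAL data the degenerate corank-two integral case of the stub has genuine small
counterexamples, so a proof of the stub must use `m ≥ 8` (or the specific exponents of the route).
No conclusion below asserts a Theses declaration positively.
-/

namespace Summit.ValiantsHypothesis.ValiantsHypothesis.Theorems.BinomialCandidate.Negative

-- summit = sub-problem name (single-conjunct summit, D-0017 layout), so the namespace repeats it
set_option linter.dupNamespace false

open MvPolynomial

/-! ## A kernel-checkable certificate for "no short integer relation" -/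

/-- `noRel es L acc nz`: exhaustive check over the integer `ℓ¹`-ball of radius `L` in `ℤ^{es.length}`
(budget-pruned enumeration): for every `w` with `Σ |wᵢ| ≤ L`, `acc + Σ wᵢ esᵢ = 0` only if `nz = false`
and `w = 0`. [folklore] -/
def noRel : List ℤ → ℕ → ℤ → Bool → Bool
  | [], _, acc, nz => !(acc == 0 && nz)
  | e :: es, L, acc, nz => (List.range (2 * L + 1)).all fun t =>
      noRel es (L - ((t : ℤ) - L).natAbs) (acc + ((t : ℤ) - L) * e) (nz || ((t : ℤ) - L != 0))

/-- Soundness of `noRel`. [folklore] -/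
theorem noRel_spec : ∀ (es : List ℤ) (L : ℕ) (acc : ℤ) (nz : Bool), noRel es L acc nz = true →
    ∀ w : List ℤ, w.length = es.length → (w.map abs).sum ≤ (L : ℤ) →
    acc + (List.zipWith (· * ·) w es).sum = 0 → nz = false ∧ ∀ c ∈ w, c = 0 := by
  intro es
  induction es with
  | nil =>
    intro L acc nz h w hw _ hacc
    have hw' : w = [] := List.eq_nil_of_length_eq_zero hw
    subst hw'
    simp only [List.zipWith_nil_left, List.sum_nil, add_zero] at hacc
    subst hacc
    revert h
    cases nz <;> simp [noRel]
  | cons e es ih =>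
    intro L acc nz h w hw hsum hacc
    cases w with
    | nil => simp at hw
    | cons c w' =>
      have hw' : w'.length = es.length := by simpa using hw
      simp only [List.map_cons, List.sum_cons] at hsum
      simp only [List.zipWith_cons_cons, List.sum_cons] at hacc
      have hnn : 0 ≤ (w'.map abs).sum := List.sum_nonneg (fun x hx => by
        obtain ⟨y, _, rfl⟩ := List.mem_map.mp hx; exact abs_nonneg y)
      have hcL : |c| ≤ (L : ℤ) := by linarith
      have habs : ((c.natAbs : ℕ) : ℤ) = |c| := Int.natCast_natAbs c
      have hle : c.natAbs ≤ L := by omega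
      have ht : (c + L).toNat ∈ List.range (2 * L + 1) := by
        rw [List.mem_range]; omega
      have htc : (((c + L).toNat : ℕ) : ℤ) - L = c := by
        rw [Int.toNat_of_nonneg (by omega)]; ring
      rw [noRel, List.all_eq_true] at h
      have h' := h _ ht
      rw [htc] at h'
      have hsum' : (w'.map abs).sum ≤ ((L - c.natAbs : ℕ) : ℤ) := by
        rw [Nat.cast_sub hle, habs]; linarith
      have hacc' : (acc + c * e) + (List.zipWith (· * ·) w' es).sum = 0 := by linarith
      obtain ⟨hnz, hzero⟩ := ih _ _ _ h' w' hw' hsum' hacc'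
      have hnz' : nz = false ∧ c = 0 := by
        revert hnz; cases nz <;> simp
      refine ⟨hnz'.1, fun x hx => ?_⟩
      rcases List.mem_cons.mp hx with rfl | hx'
      · exact hnz'.2
      · exact hzero x hx'

/-- The certificate: no nonzero integer vector of `ℓ¹`-length `≤ 4` is orthogonal to the fourteen exponents
`(a₀, b₀, a₁, b₁, …, a₆, b₆)` of the level-`7` swallower (kernel evaluation of `noRel`). [folklore] -/
theorem level7_cert :
    noRel [17, 21, 44, 108, 89, 101, 98, 130, 144, 160, 551, 706, 737, 1096] 4 0 false = true := by
  decide +kernel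

/-- The exponent data of the level-`7` swallower: first exponents. [folklore] -/
def level7a : Fin 7 → ℕ := ![17, 44, 89, 98, 144, 551, 737]

/-- The exponent data of the level-`7` swallower: second exponents. [folklore] -/
def level7b : Fin 7 → ℕ := ![21, 108, 101, 130, 160, 706, 1096]

/-- No short relation, in the stub's format: `Σ (|uᵢ| + |vᵢ|) ≤ ⌊log₂ 7⌋² = 4` and `Σ (uᵢ aᵢ + vᵢ bᵢ) = 0`
force `(u, v) = 0`. [folklore] -/
theorem level7_noShortRelation (u v : Fin 7 → ℤ)
    (hlen : ∑ i, (|u i| + |v i|) ≤ ((Nat.log 2 7 ^ 2 : ℕ) : ℤ))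
    (hrel : ∑ i, (u i * (level7a i : ℤ) + v i * (level7b i : ℤ)) = 0) : (u, v) = 0 := by
  have hlog : Nat.log 2 7 = 2 :=
    (Nat.log_eq_iff (b := 2) (m := 2) (n := 7) (Or.inl two_ne_zero)).mpr ⟨by norm_num, by norm_num⟩
  rw [hlog] at hlen
  simp only [level7a, level7b, Fin.sum_univ_seven, Matrix.cons_val_zero, Matrix.cons_val_one,
    Matrix.cons_val] at hlen hrel
  have key := noRel_spec _ 4 0 false level7_cert
    [u 0, v 0, u 1, v 1, u 2, v 2, u 3, v 3, u 4, v 4, u 5, v 5, u 6, v 6] rfl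
    (by simp only [List.map_cons, List.map_nil, List.sum_cons, List.sum_nil]; push_cast at hlen ⊢; linarith)
    (by simp only [List.zipWith_cons_cons, List.zipWith_nil_right, List.sum_cons, List.sum_nil]
        push_cast at hrel ⊢; linarith)
  obtain ⟨-, hz⟩ := key
  simp only [List.mem_cons, List.not_mem_nil, or_false, forall_eq_or_imp, forall_eq] at hz
  obtain ⟨h0, h1, h2, h3, h4, h5, h6, h7, h8, h9, h10, h11, h12, h13⟩ := hz
  refine Prod.ext (funext fun i => ?_) (funext fun i => ?_) <;> fin_cases i <;> assumption

/-! ## The level-`7` swallower -/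

/-- The quadratic map `ℂ⁶ → ℂ⁷` of the swallower (written without scalars: `2y₃ = y₃ + y₃`). [folklore] -/
noncomputable def level7Γ : Fin 7 → MvPolynomial (Fin 6) ℂ :=
  ![X 0, X 1 ^ 2 - X 3 - X 3, X 0 * X 2 - X 3 * X 0, X 3 * X 1, X 2 ^ 2 - X 3 ^ 2 - X 3 ^ 2, X 4, X 5]

/-- `t ↦ tⁿ` as a Laurent series. [folklore] -/
noncomputable abbrev level7s (n : ℕ) : LaurentSeries ℂ := HahnSeries.single (n : ℤ) (1 : ℂ)

/-- The six hidden power series of the swallower (`u₁, u₂, u₃, m` and two linear paddings). [folklore] -/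
noncomputable def level7p : Fin 6 → LaurentSeries ℂ :=
  ![level7s 17 + level7s 21, level7s 22 + level7s 54, level7s 72 + level7s 80, level7s 76,
    level7s 551 + level7s 706, level7s 737 + level7s 1096]

/-- All coordinates are quadratic. [folklore] -/
theorem level7_deg : ∀ i, (level7Γ i).totalDegree ≤ 2 := by
  have hX : ∀ j : Fin 6, (X j : MvPolynomial (Fin 6) ℂ).totalDegree ≤ 2 := fun j => by
    simp [totalDegree_X]
  have hXX : ∀ j k : Fin 6, (X j * X k : MvPolynomial (Fin 6) ℂ).totalDegree ≤ 2 := fun j k =>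
    (totalDegree_mul _ _).trans (by simp [totalDegree_X])
  have hX2 : ∀ j : Fin 6, (X j ^ 2 : MvPolynomial (Fin 6) ℂ).totalDegree ≤ 2 := fun j => by
    simp [totalDegree_X_pow]
  have hsub : ∀ f g : MvPolynomial (Fin 6) ℂ, f.totalDegree ≤ 2 → g.totalDegree ≤ 2 →
      (f - g).totalDegree ≤ 2 := fun f g hf hg => (totalDegree_sub f g).trans (max_le hf hg)
  intro i
  fin_cases i
  · exact hX 0
  · exact hsub _ _ (hsub _ _ (hX2 1) (hX 3)) (hX 3)
  · exact hsub _ _ (hXX 0 2) (hXX 3 0)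
  · exact hXX 3 1
  · exact hsub _ _ (hsub _ _ (hX2 2) (hX2 3)) (hX2 3)
  · exact hX 4
  · exact hX 5

/-- The solution equations: `Γ(p) = (tᵃⁱ + tᵇⁱ)ᵢ` (with `N = 1`). [folklore] -/
theorem level7_sol : ∀ i, MvPolynomial.aeval level7p (level7Γ i) =
    HahnSeries.single ((1 * level7a i : ℕ) : ℤ) (1 : ℂ) + HahnSeries.single ((1 * level7b i : ℕ) : ℤ) (1 : ℂ) := by
  intro i
  fin_cases i <;>
    simp only [level7Γ, level7p, level7s, level7a, level7b, Fin.zero_eta, Fin.mk_one, Fin.reduceFinMk, Fin.isValue,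
      Matrix.cons_val_zero, Matrix.cons_val_one, Matrix.cons_val, map_sub, map_mul, MvPolynomial.aeval_X, sq,
      add_mul, mul_add, HahnSeries.single_mul_single, mul_one, one_mul, Nat.cast_ofNat] <;> norm_num
  all_goals abel

/-- The base point is the origin (the solution is integral and vanishes at `t = 0`). [folklore] -/
theorem level7_base : (fun l => (level7p l).coeff 0) = 0 := by
  funext l
  fin_cases l <;> simp [level7p, level7s]

/-- All orders are nonnegative. [folklore] -/
theorem level7_ord : ∀ j, 0 ≤ (level7p j).order := by
  intro j
  by_cases hx : level7p j = 0
  · rw [hx, HahnSeries.order_zero]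
  have hc : (level7p j).coeff (level7p j).order ≠ 0 := fun h0 => hx (HahnSeries.coeff_order_eq_zero.mp h0)
  revert hc
  fin_cases j <;> simp only [level7p, level7s, Fin.zero_eta, Fin.mk_one, Fin.reduceFinMk, Fin.isValue,
    Matrix.cons_val_zero, Matrix.cons_val_one, Matrix.cons_val, HahnSeries.coeff_add', Pi.add_apply,
    HahnSeries.coeff_single] <;> intro hc <;> split_ifs at hc <;> first | omega | (exfalso; simp at hc)

/-- Jacobian column `0` at the origin: `∂₀Γ(0) = e₀`. [folklore] -/
theorem level7_J0 : ∀ i, MvPolynomial.eval (0 : Fin 6 → ℂ) (pderiv 0 (level7Γ i)) =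
    (![1, 0, 0, 0, 0, 0, 0] : Fin 7 → ℂ) i := by
  intro i; fin_cases i <;> simp [level7Γ, pderiv_X, Derivation.leibniz, sq]

/-- Jacobian column `1` at the origin vanishes (`e₁` is in the kernel). [folklore] -/
theorem level7_J1 : ∀ i, MvPolynomial.eval (0 : Fin 6 → ℂ) (pderiv 1 (level7Γ i)) = 0 := by
  intro i; fin_cases i <;> simp [level7Γ, pderiv_X, Derivation.leibniz, sq]

/-- Jacobian column `2` at the origin vanishes (`e₂` is in the kernel). [folklore] -/
theorem level7_J2 : ∀ i, MvPolynomial.eval (0 : Fin 6 → ℂ) (pderiv 2 (level7Γ i)) = 0 := by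
  intro i; fin_cases i <;> simp [level7Γ, pderiv_X, Derivation.leibniz, sq]

/-- Jacobian column `3` at the origin: `∂₃Γ(0) = -2 e₁`. [folklore] -/
theorem level7_J3 : ∀ i, MvPolynomial.eval (0 : Fin 6 → ℂ) (pderiv 3 (level7Γ i)) =
    (![0, -2, 0, 0, 0, 0, 0] : Fin 7 → ℂ) i := by
  intro i; fin_cases i <;> simp [level7Γ, pderiv_X, Derivation.leibniz, sq]
  norm_num

/-- The quadratic parts `B_i`. [folklore] -/
theorem level7_B : ∀ i, MvPolynomial.homogeneousComponent 2 (level7Γ i) =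
    (![0, X 1 ^ 2, X 0 * X 2 - X 3 * X 0, X 3 * X 1, X 2 ^ 2 - X 3 ^ 2 - X 3 ^ 2, 0, 0] :
      Fin 7 → MvPolynomial (Fin 6) ℂ) i := by
  have h1 : ∀ j : Fin 6, MvPolynomial.homogeneousComponent 2 (X j : MvPolynomial (Fin 6) ℂ) = 0 :=
    fun j => by rw [homogeneousComponent_of_mem (isHomogeneous_X ℂ j)]; simp
  have h2 : ∀ j : Fin 6, MvPolynomial.homogeneousComponent 2 (X j ^ 2 : MvPolynomial (Fin 6) ℂ) = X j ^ 2 :=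
    fun j => by rw [homogeneousComponent_of_mem (isHomogeneous_X_pow j 2)]; rfl
  have h11 : ∀ j k : Fin 6,
      MvPolynomial.homogeneousComponent 2 (X j * X k : MvPolynomial (Fin 6) ℂ) = X j * X k :=
    fun j k => by rw [homogeneousComponent_of_mem ((isHomogeneous_X ℂ j).mul (isHomogeneous_X ℂ k))]; rfl
  intro i
  fin_cases i <;> simp [level7Γ, map_sub, h1, h2, h11]

/-- `B_i(e₀) = 0` for all `i` (`Γ` is improper through `e₀`). [folklore] -/
theorem level7_Be0 : ∀ i, MvPolynomial.eval (Pi.single 0 1 : Fin 6 → ℂ)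
    (MvPolynomial.homogeneousComponent 2 (level7Γ i)) = 0 := by
  intro i; rw [level7_B i]; fin_cases i <;> simp

/-- `B_i(e₁) = δ_{i1}`. [folklore] -/
theorem level7_Be1 : ∀ i, MvPolynomial.eval (Pi.single 1 1 : Fin 6 → ℂ)
    (MvPolynomial.homogeneousComponent 2 (level7Γ i)) = (![0, 1, 0, 0, 0, 0, 0] : Fin 7 → ℂ) i := by
  intro i; rw [level7_B i]; fin_cases i <;> simp

/-! ## The level-`7` body of `Stmt.stub_integralDeep` is false -/

/-- **Level `7` of `Stmt.stub_integralDeep` fails** (body quoted verbatim with `m := 7` and `Fin (7 - 1)` written `Fin 6`,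
definitionally equal; witness: the swallower
above, `N = 1`, corank-two DEGENERATE integral base point, structure at infinity through `z = e₀`). [folklore] -/
theorem integralDeep_level_seven_false : ¬ (∀ (a b : Fin 7 → ℕ) (Γ : Fin 7 → MvPolynomial (Fin 6) ℂ) (N : ℕ)
    (p : Fin 6 → LaurentSeries ℂ), (∀ i, (Γ i).totalDegree ≤ 2) → 0 < N →
    (∀ j, 0 ≤ (p j).order) →
    (((∃ κ₁ κ₂ : Fin 6 → ℂ,
        (∀ i, ∑ j, κ₁ j * MvPolynomial.eval (fun l => (p l).coeff 0) (MvPolynomial.pderiv j (Γ i)) = 0) ∧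
        (∀ i, ∑ j, κ₂ j * MvPolynomial.eval (fun l => (p l).coeff 0) (MvPolynomial.pderiv j (Γ i)) = 0) ∧
        ∀ c₁ c₂ : ℂ, c₁ • κ₁ + c₂ • κ₂ = 0 → c₁ = 0 ∧ c₂ = 0) ∧
      ¬ (∃ (κ₁ κ₂ : Fin 6 → ℂ) (lam : Fin 3 → Fin 7 → ℂ),
          (∀ i, ∑ j, κ₁ j * MvPolynomial.eval (fun l => (p l).coeff 0) (MvPolynomial.pderiv j (Γ i)) = 0) ∧
          (∀ i, ∑ j, κ₂ j * MvPolynomial.eval (fun l => (p l).coeff 0) (MvPolynomial.pderiv j (Γ i)) = 0) ∧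
          (∀ c₁ c₂ : ℂ, c₁ • κ₁ + c₂ • κ₂ = 0 → c₁ = 0 ∧ c₂ = 0) ∧
          (∀ κ' : Fin 6 → ℂ,
            (∀ i, ∑ j, κ' j * MvPolynomial.eval (fun l => (p l).coeff 0) (MvPolynomial.pderiv j (Γ i)) = 0) →
            ∃ μ₁ μ₂ : ℂ, κ' = μ₁ • κ₁ + μ₂ • κ₂) ∧
          (∀ a : Fin 3, ∀ j : Fin 6,
            ∑ i, lam a i * MvPolynomial.eval (fun l => (p l).coeff 0) (MvPolynomial.pderiv j (Γ i)) = 0) ∧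
          (∀ c : Fin 3 → ℂ, (∀ i, ∑ a, c a * lam a i = 0) → c = 0) ∧
          (∀ x₁ x₂ : ℂ, (∀ a : Fin 3, ∑ i, lam a i *
              MvPolynomial.eval (x₁ • κ₁ + x₂ • κ₂) (MvPolynomial.homogeneousComponent 2 (Γ i)) = 0) → x₁ = 0 ∧ x₂ = 0))) ∨
      (∃ κ : Fin 6 → ℂ, κ ≠ 0 ∧
        (∀ i, ∑ j, κ j * MvPolynomial.eval (fun l => (p l).coeff 0) (MvPolynomial.pderiv j (Γ i)) = 0) ∧
        (∀ κ' : Fin 6 → ℂ,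
          (∀ i, ∑ j, κ' j * MvPolynomial.eval (fun l => (p l).coeff 0) (MvPolynomial.pderiv j (Γ i)) = 0) →
          ∃ μ : ℂ, κ' = μ • κ) ∧
        ∃ γ : Fin 6 → Polynomial ℂ, (∀ j, (γ j).coeff 0 = (p j).coeff 0) ∧ (∀ j, (γ j).coeff 1 = κ j) ∧
          ∀ i, ∀ n ≤ Nat.log 2 7 ^ 2 / 2, (MvPolynomial.aeval γ (Γ i)).coeff n = 0)) →
    (∃ z : Fin 6 → ℂ, z ≠ 0 ∧
      (((∀ i, MvPolynomial.eval z (MvPolynomial.homogeneousComponent 2 (Γ i)) = 0) ∧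
        ((∃ z' : Fin 6 → ℂ, (∀ c : ℂ, z' ≠ c • z) ∧ ∃ i₁ : Fin 7, ∀ i, i ≠ i₁ →
            ∑ j, z' j * MvPolynomial.eval z
              (MvPolynomial.pderiv j (MvPolynomial.homogeneousComponent 2 (Γ i))) = 0) ∨
          (∃ w : Fin 6 → ℂ, ∃ i₁ : Fin 7, ∀ i, i ≠ i₁ →
            ∑ j, z j * MvPolynomial.eval w (MvPolynomial.pderiv j (Γ i)) = 0))) ∨
      (∃ τ : Fin 7, (∀ i, i ≠ τ → MvPolynomial.eval z (MvPolynomial.homogeneousComponent 2 (Γ i)) = 0) ∧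
        ∃ z' : Fin 6 → ℂ, (∀ c : ℂ, z' ≠ c • z) ∧ ∃ i₁ : Fin 7, ∀ i, i ≠ τ → i ≠ i₁ →
          ∑ j, z' j * MvPolynomial.eval z
            (MvPolynomial.pderiv j (MvPolynomial.homogeneousComponent 2 (Γ i))) = 0))) →
    (∀ i, MvPolynomial.aeval p (Γ i) =
      HahnSeries.single ((N * a i : ℕ) : ℤ) (1 : ℂ) + HahnSeries.single ((N * b i : ℕ) : ℤ) (1 : ℂ)) →
    ∃ u v : Fin 7 → ℤ, (u, v) ≠ 0 ∧ ∑ i, (|u i| + |v i|) ≤ ((Nat.log 2 7 ^ 2 : ℕ) : ℤ) ∧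
      ∑ i, (u i * (a i : ℤ) + v i * (b i : ℤ)) = 0) := by
  -- the Jacobian at the base point, column by column
  have hK : ∀ (i : Fin 7) (j : Fin 6), MvPolynomial.eval (fun l => (level7p l).coeff 0)
      (MvPolynomial.pderiv j (level7Γ i)) = MvPolynomial.eval (0 : Fin 6 → ℂ) (pderiv j (level7Γ i)) := by
    intro i j; rw [level7_base]
  have hker1 : ∀ i, ∑ j, (Pi.single 1 1 : Fin 6 → ℂ) j *
      MvPolynomial.eval (fun l => (level7p l).coeff 0) (MvPolynomial.pderiv j (level7Γ i)) = 0 := by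
    intro i; simp only [hK]
    rw [Fintype.sum_eq_single (1 : Fin 6) (fun j hj => by simp [hj]), level7_J1 i]; simp
  have hker2 : ∀ i, ∑ j, (Pi.single 2 1 : Fin 6 → ℂ) j *
      MvPolynomial.eval (fun l => (level7p l).coeff 0) (MvPolynomial.pderiv j (level7Γ i)) = 0 := by
    intro i; simp only [hK]
    rw [Fintype.sum_eq_single (2 : Fin 6) (fun j hj => by simp [hj]), level7_J2 i]; simp
  have hind : ∀ c₁ c₂ : ℂ, c₁ • (Pi.single 1 1 : Fin 6 → ℂ) + c₂ • (Pi.single 2 1 : Fin 6 → ℂ) = 0 →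
      c₁ = 0 ∧ c₂ = 0 := by
    intro c₁ c₂ hc
    have h1 := congrFun hc 1
    have h2 := congrFun hc 2
    simp at h1 h2
    exact ⟨h1, h2⟩
  intro h
  refine absurd (h level7a level7b level7Γ 1 level7p level7_deg one_pos level7_ord
    (Or.inl ⟨⟨_, _, hker1, hker2, hind⟩, ?_⟩) ⟨Pi.single 0 1, ?_, Or.inl ⟨level7_Be0, Or.inr ⟨0, 0, ?_⟩⟩⟩ level7_sol) ?_
  · -- the corank-two configuration is degenerate
    rintro ⟨κ₁, κ₂, lam, -, -, -, hspan, hlam, -, hnd⟩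
    obtain ⟨μ₁, μ₂, hμ⟩ := hspan (Pi.single 1 1) hker1
    have hl1 : ∀ a, lam a 1 = 0 := by
      intro a
      have h3 := hlam a 3
      simp only [hK, level7_J3, Fin.sum_univ_seven, Matrix.cons_val_zero, Matrix.cons_val_one,
        Matrix.cons_val] at h3
      simpa using h3
    have hzero : ∀ a : Fin 3, ∑ i, lam a i *
        MvPolynomial.eval (μ₁ • κ₁ + μ₂ • κ₂) (MvPolynomial.homogeneousComponent 2 (level7Γ i)) = 0 := by
      intro a
      simp only [← hμ, level7_Be1, Fin.sum_univ_seven, Matrix.cons_val_zero, Matrix.cons_val_one,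
        Matrix.cons_val, hl1 a]
      simp
    obtain ⟨h1, h2⟩ := hnd μ₁ μ₂ hzero
    have h10 := congrFun hμ 1
    simp [h1, h2] at h10
  · exact fun h0 => by simpa using congrFun h0 0
  · -- `dΓ(0) · e₀ = e₀`: off `i = 0` it vanishes
    intro i hi
    rw [Fintype.sum_eq_single (0 : Fin 6) (fun j hj => by simp [hj]), Pi.single_eq_same, one_mul,
      level7_J0 i]
    fin_cases i <;> simp at hi ⊢
  · -- no short relation
    rintro ⟨u, v, hne, hlen, hrel⟩
    exact hne (level7_noShortRelation u v hlen hrel)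

/-- Every witness `m₀` of `Stmt.stub_integralDeep` (v6, `Cruxes/BinomialCandidate/Lines/registered.lean`; its body
at level `m` is quoted verbatim) satisfies `8 ≤ m₀`. [folklore] -/
theorem eight_le_of_integralDeep_witness (m₀ : ℕ)
    (hm : ∀ m ≥ m₀, ∀ (a b : Fin m → ℕ) (Γ : Fin m → MvPolynomial (Fin (m - 1)) ℂ) (N : ℕ)
    (p : Fin (m - 1) → LaurentSeries ℂ), (∀ i, (Γ i).totalDegree ≤ 2) → 0 < N →
    (∀ j, 0 ≤ (p j).order) →
    (((∃ κ₁ κ₂ : Fin (m - 1) → ℂ,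
        (∀ i, ∑ j, κ₁ j * MvPolynomial.eval (fun l => (p l).coeff 0) (MvPolynomial.pderiv j (Γ i)) = 0) ∧
        (∀ i, ∑ j, κ₂ j * MvPolynomial.eval (fun l => (p l).coeff 0) (MvPolynomial.pderiv j (Γ i)) = 0) ∧
        ∀ c₁ c₂ : ℂ, c₁ • κ₁ + c₂ • κ₂ = 0 → c₁ = 0 ∧ c₂ = 0) ∧
      ¬ (∃ (κ₁ κ₂ : Fin (m - 1) → ℂ) (lam : Fin 3 → Fin m → ℂ),
          (∀ i, ∑ j, κ₁ j * MvPolynomial.eval (fun l => (p l).coeff 0) (MvPolynomial.pderiv j (Γ i)) = 0) ∧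
          (∀ i, ∑ j, κ₂ j * MvPolynomial.eval (fun l => (p l).coeff 0) (MvPolynomial.pderiv j (Γ i)) = 0) ∧
          (∀ c₁ c₂ : ℂ, c₁ • κ₁ + c₂ • κ₂ = 0 → c₁ = 0 ∧ c₂ = 0) ∧
          (∀ κ' : Fin (m - 1) → ℂ,
            (∀ i, ∑ j, κ' j * MvPolynomial.eval (fun l => (p l).coeff 0) (MvPolynomial.pderiv j (Γ i)) = 0) →
            ∃ μ₁ μ₂ : ℂ, κ' = μ₁ • κ₁ + μ₂ • κ₂) ∧
          (∀ a : Fin 3, ∀ j : Fin (m - 1),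
            ∑ i, lam a i * MvPolynomial.eval (fun l => (p l).coeff 0) (MvPolynomial.pderiv j (Γ i)) = 0) ∧
          (∀ c : Fin 3 → ℂ, (∀ i, ∑ a, c a * lam a i = 0) → c = 0) ∧
          (∀ x₁ x₂ : ℂ, (∀ a : Fin 3, ∑ i, lam a i *
              MvPolynomial.eval (x₁ • κ₁ + x₂ • κ₂) (MvPolynomial.homogeneousComponent 2 (Γ i)) = 0) → x₁ = 0 ∧ x₂ = 0))) ∨
      (∃ κ : Fin (m - 1) → ℂ, κ ≠ 0 ∧
        (∀ i, ∑ j, κ j * MvPolynomial.eval (fun l => (p l).coeff 0) (MvPolynomial.pderiv j (Γ i)) = 0) ∧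
        (∀ κ' : Fin (m - 1) → ℂ,
          (∀ i, ∑ j, κ' j * MvPolynomial.eval (fun l => (p l).coeff 0) (MvPolynomial.pderiv j (Γ i)) = 0) →
          ∃ μ : ℂ, κ' = μ • κ) ∧
        ∃ γ : Fin (m - 1) → Polynomial ℂ, (∀ j, (γ j).coeff 0 = (p j).coeff 0) ∧ (∀ j, (γ j).coeff 1 = κ j) ∧
          ∀ i, ∀ n ≤ Nat.log 2 m ^ 2 / 2, (MvPolynomial.aeval γ (Γ i)).coeff n = 0)) →
    (∃ z : Fin (m - 1) → ℂ, z ≠ 0 ∧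
      (((∀ i, MvPolynomial.eval z (MvPolynomial.homogeneousComponent 2 (Γ i)) = 0) ∧
        ((∃ z' : Fin (m - 1) → ℂ, (∀ c : ℂ, z' ≠ c • z) ∧ ∃ i₁ : Fin m, ∀ i, i ≠ i₁ →
            ∑ j, z' j * MvPolynomial.eval z
              (MvPolynomial.pderiv j (MvPolynomial.homogeneousComponent 2 (Γ i))) = 0) ∨
          (∃ w : Fin (m - 1) → ℂ, ∃ i₁ : Fin m, ∀ i, i ≠ i₁ →
            ∑ j, z j * MvPolynomial.eval w (MvPolynomial.pderiv j (Γ i)) = 0))) ∨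
      (∃ τ : Fin m, (∀ i, i ≠ τ → MvPolynomial.eval z (MvPolynomial.homogeneousComponent 2 (Γ i)) = 0) ∧
        ∃ z' : Fin (m - 1) → ℂ, (∀ c : ℂ, z' ≠ c • z) ∧ ∃ i₁ : Fin m, ∀ i, i ≠ τ → i ≠ i₁ →
          ∑ j, z' j * MvPolynomial.eval z
            (MvPolynomial.pderiv j (MvPolynomial.homogeneousComponent 2 (Γ i))) = 0))) →
    (∀ i, MvPolynomial.aeval p (Γ i) =
      HahnSeries.single ((N * a i : ℕ) : ℤ) (1 : ℂ) + HahnSeries.single ((N * b i : ℕ) : ℤ) (1 : ℂ)) →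
    ∃ u v : Fin m → ℤ, (u, v) ≠ 0 ∧ ∑ i, (|u i| + |v i|) ≤ ((Nat.log 2 m ^ 2 : ℕ) : ℤ) ∧
      ∑ i, (u i * (a i : ℤ) + v i * (b i : ℤ)) = 0) :
    8 ≤ m₀ := by
  by_contra hlt
  exact integralDeep_level_seven_false (hm 7 (by omega))

end Summit.ValiantsHypothesis.ValiantsHypothesis.Theorems.BinomialCandidate.Negative
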